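import Summits.HubbardSuperconductivity.HubbardSuperconductivity.Theorems.AnisotropyChordSpinMonotoneTwoMagnonEdgeTransitive

/-!
# Route `AnisotropyChord`: the two-magnon sector of an edge-transitive graph as a RANK-ONE BRANCH
# (set-up shared by the Gram-TP₂ / overlap-monotonicity theorems; packaging of the construction
# inside `twoMagnon_condensate_monotone_of_edgeTransitive`)

For a finite connected vertex- and edge-transitive graph `G` (`k`-regular, `m = |E|` edges) the
sector ground states of `H(Δ) = xxzHamiltonian 1 G (−1) Δ` in the two-magnon sector
`S^z_tot = |V|/2 − 2` live, by Perron–Frobenius, on the `Aut G`-invariant block `𝓜 = K ∩ 𝓘`, and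
there (file `…TwoMagnonInvariant`)

  `H(Δ)|_𝓜 = L + ((1−Δ)/m)|t⟩⟨t| + const`,  `L = H(1) + m/4 ⪰ 0`,  `L e = 0`,

`e = φ/√N` the normalised flat vector, `t` the contact (adjacent-pair) indicator, `⟨e, t⟩ ≠ 0`.

* `twoMagnon_branch_setup` — packages `L, 𝓜, e, t` with: `L ⪰ 0`, `𝓜` `L`-invariant, `e, t ∈ 𝓜`,
  `L e = 0`, `‖e‖ = 1`, `⟨e,t⟩ ≠ 0`, `e = r φ` (`r > 0`), and FOR EVERY `Δ < 1` and every normalised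
  sector ground state `ψ` of `H(Δ)`: `ψ ∈ 𝓜`, the branch equation
  `L ψ + σ(Δ)⟨t,ψ⟩ t = ε(Δ) ψ` with `σ(Δ) = (1−Δ)/m > 0`,
  `ε(Δ) = E(Δ) − (1−Δ)(m/4 − k) + m/4` (`E(Δ)` the sector energy), `⟨t,ψ⟩ ≠ 0`, the variational
  property of `ε(Δ)` on `𝓜 ∩ t^⊥` and its uniqueness property there — i.e. exactly the hypotheses
  of the abstract branch lemmas of `…ResolventGramTPBranch` / `…ResolventGramTPMinors` /
  `…ResolventBranch`; and at `Δ = 1`: every normalised sector ground state is `c e`, `|c| = 1`.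
* `twoMagnon_level_antitone` — `Δ ≤ Δ' ⇒ ε(Δ') ≤ ε(Δ)` (variational principle at `Δ'` tested on the
  ground state at `Δ`): the level `ε` DEcreases with the anisotropy, so the TP₂ rows/columns of the
  abstract lemmas are ordered by decreasing `Δ`.

Everything here is a re-packaging of steps of `twoMagnon_condensate_monotone_of_edgeTransitive`
(theory seat `hubbard-h0-rotor-theory-1`, cycle 4, one contact orbit); H. Tasaki, *Physics and
Mathematics of Quantum Many-Body Systems* (2020) §2.4, App. A.2–A.3.  No definition is introduced.
-/

set_option linter.dupNamespace false

noncomputable section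

namespace Summit.HubbardSuperconductivity.HubbardSuperconductivity.Theorems.AnisotropyChord.TwoMagnon

open Matrix Complex Finset
open scoped ComplexOrder InnerProductSpace
open Literature.MathematicalPhysics.QuantumLattice Literature.Probability.LatticeModels
open Literature.Combinatorics.SimpleGraph (IsVertexTransitive)
open Literature.Combinatorics.SimpleGraph.LovaszThetaEdgeTransitive (IsEdgeTransitive)
open Literature.Combinatorics.SimpleGraph.RankThreeStronglyRegular (isRegularOfDegree_of_isVertexTransitive)
open Summit.HubbardSuperconductivity.HubbardSuperconductivity.Theorems.AnisotropyChord.OneMagnon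
open Summit.HubbardSuperconductivity.HubbardSuperconductivity.Theorems.LevyLogBootstrap

variable {V : Type*} [Fintype V] [DecidableEq V]

/-- **The branch level decreases with the anisotropy**: on a `k`-regular edge-transitive graph with
`m ≠ 0` edges, for `Δ ≤ Δ'` and a normalised `Aut`-invariant sector ground state `ψ` of `H(Δ)` in the
two-magnon sector, `E(Δ') − (1−Δ')(m/4−k) ≤ E(Δ) − (1−Δ)(m/4−k)` (variational principle at `Δ'`
tested on `ψ`, and `(1−Δ')/m ≤ (1−Δ)/m`). Tasaki (2020) App. A.2. [folklore] -/
theorem twoMagnon_level_antitone (G : SimpleGraph V) [DecidableRel G.Adj]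
    (hET : IsEdgeTransitive G) {k : ℕ} (hreg : G.IsRegularOfDegree k) (hm : G.edgeFinset.card ≠ 0)
    {t : (V → Fin 2) → ℂ}
    (ht2 : ∀ a b : V, a ≠ b → t (Pi.single a 1 + Pi.single b 1) = if G.Adj a b then 1 else 0)
    (ht0 : ∀ σ : V → Fin 2, (∑ z, (σ z : ℕ)) ≠ 2 → t σ = 0)
    {Δ Δ' : ℝ} (hle : Δ ≤ Δ') {ψ : (V → Fin 2) → ℂ}
    (gm : ψ ∈ spinZSector (Λ := V) 1 ((Fintype.card V : ℝ) / 2 - 2)) (gn : star ψ ⬝ᵥ ψ = 1)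
    (ge : xxzHamiltonian 1 G (-1) Δ *ᵥ ψ =
      ((lowestEnergyInSector 1 (xxzHamiltonian 1 G (-1) Δ) ((Fintype.card V : ℝ) / 2 - 2) : ℝ) : ℂ) • ψ)
    (hfix : ∀ π : V ≃ V, (∀ x y, G.Adj (π x) (π y) ↔ G.Adj x y) → ∀ σ, ψ (σ ∘ π) = ψ σ) :
    lowestEnergyInSector 1 (xxzHamiltonian 1 G (-1) Δ') ((Fintype.card V : ℝ) / 2 - 2)
        - (1 - Δ') * ((G.edgeFinset.card : ℝ) / 4 - k) ≤
      lowestEnergyInSector 1 (xxzHamiltonian 1 G (-1) Δ) ((Fintype.card V : ℝ) / 2 - 2)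
        - (1 - Δ) * ((G.edgeFinset.card : ℝ) / 4 - k) := by
  have hmpos : (0 : ℝ) < G.edgeFinset.card := by exact_mod_cast Nat.pos_of_ne_zero hm
  have hv : lowestEnergyInSector 1 (xxzHamiltonian 1 G (-1) Δ') ((Fintype.card V : ℝ) / 2 - 2) ≤
      (star ψ ⬝ᵥ (xxzHamiltonian 1 G (-1) Δ' *ᵥ ψ)).re :=
    sectorEnergy_le_re_form 1 G gm gn
  have hf₂ := re_form_of_invariant hET hreg hm ht2 ht0 gm hfix Δ'
  have hf₁ := re_form_of_invariant hET hreg hm ht2 ht0 gm hfix Δ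
  have hE₁ : (star ψ ⬝ᵥ (xxzHamiltonian 1 G (-1) Δ *ᵥ ψ)).re =
      lowestEnergyInSector 1 (xxzHamiltonian 1 G (-1) Δ) ((Fintype.card V : ℝ) / 2 - 2) :=
    re_form_of_sectorGS 1 G gn ge
  rw [gn, Complex.one_re, mul_one] at hf₁ hf₂
  have hb : 0 ≤ ‖star t ⬝ᵥ ψ‖ ^ 2 := by positivity
  have hcoef : (1 - Δ') / (G.edgeFinset.card : ℝ) ≤ (1 - Δ) / (G.edgeFinset.card : ℝ) :=
    div_le_div_of_nonneg_right (by linarith) hmpos.le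
  nlinarith [mul_le_mul_of_nonneg_right hcoef hb]

/-- **The two-magnon sector of a connected vertex- and edge-transitive graph as a rank-one branch**
(see the module docstring): existence of `L ⪰ 0`, an `L`-invariant subspace `𝓜`, the normalised flat
vector `e = r φ ∈ 𝓜 ∩ ker L` and the contact indicator `t ∈ 𝓜` with `⟨e,t⟩ ≠ 0`, such that every
normalised sector ground state `ψ` of `H(Δ)`, `Δ < 1`, lies in `𝓜` and satisfies
`L ψ + ((1−Δ)/m)⟨t,ψ⟩ t = ε(Δ) ψ`, `ε(Δ) = E(Δ) − (1−Δ)(m/4 − deg x₀) + m/4`, with `⟨t,ψ⟩ ≠ 0` and the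
variational and uniqueness properties of `ε(Δ)` on `𝓜 ∩ t^⊥`; and every normalised sector ground
state at `Δ = 1` is a unimodular multiple of `e`.  Packaging of
`twoMagnon_condensate_monotone_of_edgeTransitive`; Tasaki (2020) §2.4, App. A. [folklore] -/
theorem twoMagnon_branch_setup (G : SimpleGraph V) [DecidableRel G.Adj]
    (hG : G.Connected) (hVT : IsVertexTransitive G) (hET : IsEdgeTransitive G) (x₀ : V)
    {φ : (V → Fin 2) → ℂ} (hφ : ∀ σ, φ σ = if (∑ z, (σ z : ℕ)) = 2 then 1 else 0) (hφ0 : φ ≠ 0) :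
    ∃ (L : Op V 2) (𝓜 : Submodule ℂ ((V → Fin 2) → ℂ)) (e t : (V → Fin 2) → ℂ) (r : ℝ),
      L.PosSemidef ∧ (∀ v ∈ 𝓜, L *ᵥ v ∈ 𝓜) ∧ e ∈ 𝓜 ∧ t ∈ 𝓜 ∧ L *ᵥ e = 0 ∧ star e ⬝ᵥ e = 1 ∧
      star e ⬝ᵥ t ≠ 0 ∧ 0 < r ∧ e = ((r : ℝ) : ℂ) • φ ∧
      (∀ (ψ : (V → Fin 2) → ℂ), ψ ∈ spinZSector (Λ := V) 1 ((Fintype.card V : ℝ) / 2 - 2) →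
        star ψ ⬝ᵥ ψ = 1 →
        xxzHamiltonian 1 G (-1) 1 *ᵥ ψ =
          ((lowestEnergyInSector 1 (xxzHamiltonian 1 G (-1) 1) ((Fintype.card V : ℝ) / 2 - 2) : ℝ) : ℂ) • ψ →
        ∃ c : ℂ, ‖c‖ = 1 ∧ ψ = c • e) ∧
      ∀ (Δ : ℝ) (ψ : (V → Fin 2) → ℂ), Δ < 1 →
        ψ ∈ spinZSector (Λ := V) 1 ((Fintype.card V : ℝ) / 2 - 2) → star ψ ⬝ᵥ ψ = 1 →
        xxzHamiltonian 1 G (-1) Δ *ᵥ ψ =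
          ((lowestEnergyInSector 1 (xxzHamiltonian 1 G (-1) Δ) ((Fintype.card V : ℝ) / 2 - 2) : ℝ) : ℂ) • ψ →
        ψ ∈ 𝓜 ∧ 0 < (1 - Δ) / (G.edgeFinset.card : ℝ) ∧
        L *ᵥ ψ + ((((1 - Δ) / (G.edgeFinset.card : ℝ) : ℝ) : ℂ) * (star t ⬝ᵥ ψ)) • t =
          ((lowestEnergyInSector 1 (xxzHamiltonian 1 G (-1) Δ) ((Fintype.card V : ℝ) / 2 - 2)
            - (1 - Δ) * ((G.edgeFinset.card : ℝ) / 4 - G.degree x₀)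
            + (G.edgeFinset.card : ℝ) / 4 : ℝ) : ℂ) • ψ ∧
        star t ⬝ᵥ ψ ≠ 0 ∧
        (∀ π : V ≃ V, (∀ x y, G.Adj (π x) (π y) ↔ G.Adj x y) → ∀ σ, ψ (σ ∘ π) = ψ σ) ∧
        (∀ f ∈ 𝓜, star t ⬝ᵥ f = 0 →
          (lowestEnergyInSector 1 (xxzHamiltonian 1 G (-1) Δ) ((Fintype.card V : ℝ) / 2 - 2)
            - (1 - Δ) * ((G.edgeFinset.card : ℝ) / 4 - G.degree x₀)
            + (G.edgeFinset.card : ℝ) / 4) * (star f ⬝ᵥ f).re ≤ (star f ⬝ᵥ (L *ᵥ f)).re) ∧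
        (∀ g ∈ 𝓜, star t ⬝ᵥ g = 0 →
          L *ᵥ g = ((lowestEnergyInSector 1 (xxzHamiltonian 1 G (-1) Δ) ((Fintype.card V : ℝ) / 2 - 2)
            - (1 - Δ) * ((G.edgeFinset.card : ℝ) / 4 - G.degree x₀)
            + (G.edgeFinset.card : ℝ) / 4 : ℝ) : ℂ) • g → g = 0) := by
  -- an edge and regularity
  obtain ⟨σ₀, hσ₀⟩ := Function.ne_iff.mp hφ0
  have hw : (∑ z, (σ₀ z : ℕ)) = 2 := by
    by_contra h
    exact hσ₀ (by rw [hφ σ₀, if_neg h]; rfl)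
  obtain ⟨i₀, j₀, hij₀, -⟩ := eq_pair_of_weight_eq_two hw
  have hm : G.edgeFinset.card ≠ 0 := by
    obtain ⟨p⟩ := hG.preconnected i₀ j₀
    cases p with
    | nil => exact absurd rfl hij₀
    | cons h _ =>
      exact Finset.card_ne_zero_of_mem (SimpleGraph.mem_edgeFinset.2 ((SimpleGraph.mem_edgeSet G).2 h))
  have hmpos : (0 : ℝ) < G.edgeFinset.card := by exact_mod_cast Nat.pos_of_ne_zero hm
  have hreg : G.IsRegularOfDegree (G.degree x₀) := isRegularOfDegree_of_isVertexTransitive hVT x₀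
  set k : ℕ := G.degree x₀ with hkdef
  set m : ℕ := G.edgeFinset.card with hmdef
  obtain ⟨t, ht2, ht0⟩ := exists_adjInd G
  -- ⟨φ, φ⟩ = N > 0
  obtain ⟨N, hNdef⟩ : ∃ N : ℕ, N = (Finset.univ.filter fun σ : V → Fin 2 => (∑ z, (σ z : ℕ)) = 2).card :=
    ⟨_, rfl⟩
  have hφφ : star φ ⬝ᵥ φ = (N : ℂ) := by
    rw [star_flat_dotProduct hφ (fun σ h => by rw [hφ σ, if_neg h]), hNdef, Finset.card_filter]
    push_cast
    exact Finset.sum_congr rfl fun σ _ => by rw [hφ σ]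
  have hNpos : 0 < N := by
    rw [hNdef, Finset.card_pos]
    exact ⟨σ₀, Finset.mem_filter.2 ⟨Finset.mem_univ _, hw⟩⟩
  -- the invariant block
  set K := spinZSector (Λ := V) 1 ((Fintype.card V : ℝ) / 2 - 2) with hKdef
  set 𝓘 : Submodule ℂ ((V → Fin 2) → ℂ) := ⨅ (π : V ≃ V),
    ⨅ (_ : ∀ x y, G.Adj (π x) (π y) ↔ G.Adj x y),
      LinearMap.eqLocus (LinearMap.funLeft ℂ ℂ (fun σ : V → Fin 2 => σ ∘ π)) LinearMap.id with h𝓘def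
  have hmem𝓘 : ∀ f : (V → Fin 2) → ℂ, f ∈ 𝓘 ↔
      ∀ π : V ≃ V, (∀ x y, G.Adj (π x) (π y) ↔ G.Adj x y) → ∀ σ, f (σ ∘ π) = f σ := by
    intro f
    simp only [h𝓘def, Submodule.mem_iInf, LinearMap.mem_eqLocus, LinearMap.id_coe, id_eq]
    constructor
    · intro h π hπ σ
      have h' := congrFun (h π hπ) σ
      rwa [LinearMap.funLeft_apply] at h'
    · intro h π hπ
      funext σ
      rw [LinearMap.funLeft_apply]
      exact h π hπ σ
  set 𝓜 : Submodule ℂ ((V → Fin 2) → ℂ) := K ⊓ 𝓘 with h𝓜def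
  have hmem𝓜 : ∀ f, f ∈ 𝓜 ↔ f ∈ K ∧
      ∀ π : V ≃ V, (∀ x y, G.Adj (π x) (π y) ↔ G.Adj x y) → ∀ σ, f (σ ∘ π) = f σ := by
    intro f
    rw [h𝓜def, Submodule.mem_inf, hmem𝓘]
  -- the operator `L = H(1) + m/4`
  set L : Op V 2 := xxzHamiltonian 1 G (-1) 1 + (((m : ℝ) / 4 : ℝ) : ℂ) • (1 : Op V 2) with hLdef
  have hL : L.PosSemidef := posSemidef_xxzOne_add G
  have hLmul : ∀ v : (V → Fin 2) → ℂ, L *ᵥ v = xxzHamiltonian 1 G (-1) 1 *ᵥ v + (((m : ℝ) / 4 : ℝ) : ℂ) • v := by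
    intro v
    rw [hLdef, add_mulVec, smul_mulVec, one_mulVec]
  have hH1inv := xxzHamiltonian_submatrix_comp 1 G (-1) 1
  have h𝓜L : ∀ v ∈ 𝓜, L *ᵥ v ∈ 𝓜 := by
    intro v hv
    obtain ⟨hvK, hvfix⟩ := (hmem𝓜 v).1 hv
    refine (hmem𝓜 _).2 ⟨?_, ?_⟩
    · rw [hLmul]
      refine K.add_mem ?_ (K.smul_mem _ hvK)
      rw [xxz_at_one_eq_neg_heisenberg, neg_mulVec]
      exact K.neg_mem (heisenberg_mulVec_mem_spinZSector 1 G 1 hvK)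
    · intro π hπ σ
      have hvπ : (fun σ => v (σ ∘ π)) = v := funext (hvfix π hπ)
      have h := congrFun (mulVec_comp_of_submatrix_eq π (hH1inv π hπ) v) σ
      rw [hvπ] at h
      rw [hLmul, Pi.add_apply, Pi.add_apply, Pi.smul_apply, Pi.smul_apply, ← h, hvfix π hπ σ]
  -- the normalised flat vector `e`
  obtain ⟨r, hrdef⟩ : ∃ r : ℝ, r = 1 / Real.sqrt (N : ℝ) := ⟨_, rfl⟩
  have hNr0 : (0 : ℝ) < N := by exact_mod_cast hNpos
  have hrpos : 0 < r := by rw [hrdef]; exact div_pos one_pos (Real.sqrt_pos.2 hNr0)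
  have hr2 : r ^ 2 * N = 1 := by
    rw [hrdef, div_pow, one_pow, Real.sq_sqrt hNr0.le]
    field_simp
  set e : (V → Fin 2) → ℂ := ((r : ℝ) : ℂ) • φ with hedef
  have hφK : φ ∈ K := flat_mem_twoMagnonSector hφ
  have hφ𝓜 : φ ∈ 𝓜 := (hmem𝓜 φ).2 ⟨hφK, fun π _ σ => flat_comp_equiv hφ π σ⟩
  have he𝓜 : e ∈ 𝓜 := 𝓜.smul_mem _ hφ𝓜
  have ht𝓜 : t ∈ 𝓜 := (hmem𝓜 t).2 ⟨adjInd_mem_twoMagnonSector ht0, fun π hπ σ => adjInd_comp_equiv ht2 ht0 π hπ σ⟩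
  have hLφ : L *ᵥ φ = 0 := by
    rw [hLmul, xxzOne_mulVec_flat G hφ, ← add_smul]
    have : (-((G.edgeFinset.card : ℂ) / 4) + (((m : ℝ) / 4 : ℝ) : ℂ)) = 0 := by
      rw [hmdef]; push_cast; ring
    rw [this, zero_smul]
  have hLe : L *ᵥ e = 0 := by rw [hedef, mulVec_smul, hLφ, smul_zero]
  have he1 : star e ⬝ᵥ e = 1 := by
    rw [hedef, star_smul, smul_dotProduct, dotProduct_smul, hφφ, smul_eq_mul, smul_eq_mul,
      Complex.star_def, Complex.conj_ofReal, ← mul_assoc, ← Complex.ofReal_mul, ← pow_two,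
      ← Complex.ofReal_natCast, ← Complex.ofReal_mul, hr2, Complex.ofReal_one]
  have htφ : star t ⬝ᵥ φ = (m : ℂ) := star_adjInd_dotProduct_flat ht2 ht0 hφ
  have ha0 : star e ⬝ᵥ t ≠ 0 := by
    rw [hedef, star_smul, smul_dotProduct, smul_eq_mul, Complex.star_def, Complex.conj_ofReal,
      star_dotProduct φ t, htφ]
    refine mul_ne_zero (by exact_mod_cast hrpos.ne') ?_
    rw [star_ne_zero]
    exact_mod_cast hm
  refine ⟨L, 𝓜, e, t, r, hL, h𝓜L, he𝓜, ht𝓜, hLe, he1, ha0, hrpos, rfl, ?_, ?_⟩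
  · -- the `Δ = 1` end point
    intro ψ gm gn ge
    obtain ⟨c, hc⟩ := sectorGS_at_one_eq_smul_flat G hG hφ hφ0 gm ge
    have hcc : ‖c‖ ^ 2 * N = 1 := by
      have h := gn
      rw [hc, star_smul, smul_dotProduct, dotProduct_smul, hφφ, smul_eq_mul, smul_eq_mul,
        Complex.star_def, ← mul_assoc, Complex.conj_mul'] at h
      exact_mod_cast h
    refine ⟨c / r, ?_, ?_⟩
    · have hN0 : (N : ℝ) ≠ 0 := hNr0.ne'
      have e1 : ‖c‖ ^ 2 = 1 / N := by rw [eq_div_iff hN0]; exact hcc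
      have e2 : r ^ 2 = 1 / N := by rw [eq_div_iff hN0]; exact hr2
      have h1 : ‖c‖ ^ 2 = r ^ 2 := by rw [e1, e2]
      have h2 : ‖c‖ = r := by
        have h3 : (‖c‖ - r) * (‖c‖ + r) = 0 := by
          have : (‖c‖ - r) * (‖c‖ + r) = ‖c‖ ^ 2 - r ^ 2 := by ring
          rw [this, h1, sub_self]
        rcases mul_eq_zero.1 h3 with h | h
        · linarith
        · linarith [norm_nonneg c]
      rw [norm_div, Complex.norm_real, Real.norm_of_nonneg hrpos.le, h2, div_self hrpos.ne']
    · rw [hc, hedef, smul_smul, div_mul_cancel₀ c (by exact_mod_cast hrpos.ne')]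
  · -- states on the branch, `Δ < 1`
    intro Δ ψ hΔ gm gn ge
    have hψ0 : ψ ≠ 0 := by
      intro h; rw [h, dotProduct_zero] at gn; exact zero_ne_one gn
    have hfix : ∀ π : V ≃ V, (∀ x y, G.Adj (π x) (π y) ↔ G.Adj x y) → ∀ σ, ψ (σ ∘ π) = ψ σ :=
      fun π hπ σ => congrFun (sectorGS_comp_eq_self G hG Δ _ π hπ gm ge) σ
    have hψ𝓜 : ψ ∈ 𝓜 := (hmem𝓜 ψ).2 ⟨gm, hfix⟩
    have hs : 0 < (1 - Δ) / (G.edgeFinset.card : ℝ) := div_pos (by linarith) hmpos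
    set E : ℝ := lowestEnergyInSector 1 (xxzHamiltonian 1 G (-1) Δ) ((Fintype.card V : ℝ) / 2 - 2)
      with hEdef
    have hId := xxz_mulVec_of_invariant hET hreg hm ht2 ht0 gm hfix
    have heq : L *ᵥ ψ + ((((1 - Δ) / (G.edgeFinset.card : ℝ) : ℝ) : ℂ) * (star t ⬝ᵥ ψ)) • t =
        ((E - (1 - Δ) * ((G.edgeFinset.card : ℝ) / 4 - G.degree x₀)
          + (G.edgeFinset.card : ℝ) / 4 : ℝ) : ℂ) • ψ := by
      have h := hId Δ
      rw [ge] at h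
      funext σ
      have hσ := congrFun h σ
      simp only [Pi.add_apply, Pi.smul_apply, smul_eq_mul] at hσ ⊢
      rw [hLmul, Pi.add_apply, Pi.smul_apply, smul_eq_mul]
      rw [hmdef]
      push_cast at hσ ⊢
      linear_combination -hσ
    have hb : star t ⬝ᵥ ψ ≠ 0 := sectorGS_contact_ne_zero hG hET hreg hm ht2 ht0 hφ gm gn ge hfix
    refine ⟨hψ𝓜, hs, heq, hb, hfix, ?_, ?_⟩
    · -- variational property on `𝓜 ∩ t^⊥`
      intro f hf hft
      obtain ⟨hfK, hffix⟩ := (hmem𝓜 f).1 hf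
      have hv : E * (star f ⬝ᵥ f).re ≤ (star f ⬝ᵥ (xxzHamiltonian 1 G (-1) Δ *ᵥ f)).re :=
        minEnergyOn_mul_le_re_rayleigh (xxzHamiltonian_isHermitian 1 G (-1) Δ) K hfK
      have hff := re_form_of_invariant hET hreg hm ht2 ht0 hfK hffix Δ
      rw [hft, norm_zero, zero_pow two_ne_zero, mul_zero, add_zero] at hff
      have hLf : (star f ⬝ᵥ (L *ᵥ f)).re =
          (star f ⬝ᵥ (xxzHamiltonian 1 G (-1) 1 *ᵥ f)).re + (m : ℝ) / 4 * (star f ⬝ᵥ f).re := by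
        rw [hLmul, dotProduct_add, dotProduct_smul, Complex.add_re, smul_eq_mul, Complex.re_ofReal_mul]
      rw [hLf, hmdef, hkdef]
      nlinarith
    · -- uniqueness property on `𝓜 ∩ t^⊥`
      intro g hg hgt hLg
      obtain ⟨hgK, hgfix⟩ := (hmem𝓜 g).1 hg
      have hHg : xxzHamiltonian 1 G (-1) Δ *ᵥ g = ((E : ℝ) : ℂ) • g := by
        have h := xxz_mulVec_of_invariant hET hreg hm ht2 ht0 hgK hgfix Δ
        rw [hgt, mul_zero, zero_smul, add_zero] at h
        have hL' : xxzHamiltonian 1 G (-1) 1 *ᵥ g =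
            ((E - (1 - Δ) * ((G.edgeFinset.card : ℝ) / 4 - G.degree x₀)
              + (G.edgeFinset.card : ℝ) / 4 : ℝ) : ℂ) • g - (((m : ℝ) / 4 : ℝ) : ℂ) • g := by
          rw [← hLg, hLmul, add_sub_cancel_right]
        rw [h, hL', hmdef, hkdef]
        funext σ
        simp only [Pi.add_apply, Pi.sub_apply, Pi.smul_apply, smul_eq_mul]
        push_cast
        ring
      obtain ⟨c, hc⟩ := sectorGS_smul_of_sectorGS G hG Δ _ gm hψ0 ge hgK hHg
      have hc0 : c = 0 := by
        rw [hc, dotProduct_smul, smul_eq_mul] at hgt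
        rcases mul_eq_zero.1 hgt with h | h
        · exact h
        · exact absurd h hb
      rw [hc, hc0, zero_smul]

end Summit.HubbardSuperconductivity.HubbardSuperconductivity.Theorems.AnisotropyChord.TwoMagnon
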